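import Literature.AnabelianGeometry.SemiGraphs.TreeSystemGeodesicBaseEdges
import HarnessLib

/-!
# The image of a walk covers the geodesic (node-general form) and the local structure of a path at a
# branch-point of the barycentric subdivision ([SemiAnbd] §1, Thm 3.7 (iii))

Mochizuki, *Semi-graphs of anabelioids*, Publ. RIMS **42** (2006), §1 pp. 11–13 (semi-graphs, branches,
the barycentric subdivision implicit in "paths of closed edges") and §3 Theorem 3.7 (iii), proof p. 41
[cite: MochizukiSemiAnbd2006, Thm 3.7(iii) p.41].

PROOF-ONLY (cell abc-iut, block F, seat abc-iut-f-175 gen 3; pure `SemiGraph` tool lemmas for the bricks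
(C)/(D) of «CONFINED@TOP-CYCLIC-TREES», rows F-2772/F-2773; no definition, no named fact):
* `exists_mem_support_map_eq_of_isPath` — abc-iut-f-172 gen 5's `exists_mem_support_map_eq_of_mem_geodesic`
  for ANY graph homomorphism of subdivisions and ANY end nodes (vertex-, edge- or branch-points): every node
  of a path of an acyclic subdivision is the image of a node of any walk mapping onto its ends;
  `support_subset_support_of_isPath` — the identity case (paths lie on every walk with the same ends);
* `edge_and_vertex_mem_support_of_branch_mem_support` — on a path from a vertex-point, an INTERIOR
  branch-point is flanked by its edge-point and by the point of the vertex it abuts to, both on the path.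

Nothing here bears on [IUTchIII] Cor. 3.12; typed ≠ proved elsewhere.
-/

namespace Literature.AnabelianGeometry.SemiGraphs

open CategoryTheory

universe u

namespace SemiGraph

variable {G G' : SemiGraph.{u}}

/-- **The image of a walk covers the geodesic between the images of its ends** — node-general form of
abc-iut-f-172's `exists_mem_support_map_eq_of_mem_geodesic` (any graph homomorphism of subdivisions, any
end nodes). [cite: MochizukiSemiAnbd2006, Thm 3.7(iii) p.41] -/
theorem exists_mem_support_map_eq_of_isPath (hG' : G'.subdivision.IsAcyclic)
    (Φ : G.subdivision →g G'.subdivision) {x y : G.Node} (p : G.subdivision.Walk x y) {x' y' : G'.Node}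
    (hx : Φ x = x') (hy : Φ y = y') (q : G'.subdivision.Walk x' y') (hq : q.IsPath) {z : G'.Node}
    (hz : z ∈ q.support) : ∃ z' ∈ p.support, Φ z' = z := by
  classical
  subst hx hy
  have hb : (p.map Φ).bypass = q :=
    congrArg Subtype.val (hG'.path_unique ⟨(p.map Φ).bypass, (p.map Φ).bypass_isPath⟩ ⟨q, hq⟩)
  have hzW : z ∈ (p.map Φ).support := (p.map Φ).support_bypass_subset_support (by rw [hb]; exact hz)
  rw [SimpleGraph.Walk.support_map] at hzW
  obtain ⟨z', hz', rfl⟩ := List.mem_map.1 hzW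
  exact ⟨z', hz', rfl⟩

/-- Paths are unique: the nodes of a path lie on every walk with the same ends (acyclic subdivision).
[cite: MochizukiSemiAnbd2006, Thm 3.7(iii) p.41] -/
theorem support_subset_support_of_isPath (hG : G.subdivision.IsAcyclic) {x y : G.Node}
    (p q : G.subdivision.Walk x y) (hq : q.IsPath) : q.support ⊆ p.support := by
  intro z hz
  obtain ⟨z', hz', e⟩ := exists_mem_support_map_eq_of_isPath hG SimpleGraph.Hom.id p rfl rfl q hq hz
  exact e ▸ hz'

/-- **Local structure of a path at a branch-point**: on a path of the subdivision from a vertex-point, an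
INTERIOR branch-point `β` is flanked by its edge-point and by the point of the vertex it abuts to; in
particular both lie on the path. [cite: MochizukiSemiAnbd2006, §1 pp.11-12] -/
theorem edge_and_vertex_mem_support_of_branch_mem_support {a : G.Vertex} {y : G.Node}
    (p : G.subdivision.Walk (Sum.inl a) y) (hp : p.IsPath) {β : G.Branch}
    (hβ : (Sum.inr (Sum.inr β) : G.Node) ∈ p.support) (hβy : (Sum.inr (Sum.inr β) : G.Node) ≠ y) :
    (Sum.inr (Sum.inl (G.edgeOf β)) : G.Node) ∈ p.support ∧
      ∃ t : G.Vertex, G.abuts β = some t ∧ (Sum.inl t : G.Node) ∈ p.support := by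
  obtain ⟨i, hi, hile⟩ := SimpleGraph.Walk.mem_support_iff_exists_getVert.mp hβ
  have hi0 : i ≠ 0 := by
    rintro rfl
    rw [SimpleGraph.Walk.getVert_zero] at hi
    simp at hi
  have hil : i ≠ p.length := by
    rintro rfl
    rw [SimpleGraph.Walk.getVert_length] at hi
    exact hβy hi.symm
  have hilt : i < p.length := lt_of_le_of_ne hile hil
  -- the two neighbours of `β` on the path
  have h₁ : G.subdivision.Adj (Sum.inr (Sum.inr β)) (p.getVert (i - 1)) := by
    have h := p.adj_getVert_succ (i := i - 1) (by omega)
    rw [show i - 1 + 1 = i by omega, hi] at h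
    exact h.symm
  have h₂ : G.subdivision.Adj (Sum.inr (Sum.inr β)) (p.getVert (i + 1)) := by
    have h := p.adj_getVert_succ (i := i) hilt
    rw [hi] at h
    exact h
  have hne : p.getVert (i - 1) ≠ p.getVert (i + 1) := by
    intro h
    have := hp.getVert_injOn (by simp; omega) (by simp; omega) h
    omega
  have hm₁ : p.getVert (i - 1) ∈ p.support := p.getVert_mem_support _
  have hm₂ : p.getVert (i + 1) ∈ p.support := p.getVert_mem_support _
  rcases (G.subdivision_adj_branch_iff β _).mp h₁ with e₁ | ⟨t₁, ht₁, e₁⟩ <;>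
    rcases (G.subdivision_adj_branch_iff β _).mp h₂ with e₂ | ⟨t₂, ht₂, e₂⟩
  · exact (hne (e₁.trans e₂.symm)).elim
  · exact ⟨e₁ ▸ hm₁, t₂, ht₂, e₂ ▸ hm₂⟩
  · exact ⟨e₂ ▸ hm₂, t₁, ht₁, e₁ ▸ hm₁⟩
  · exfalso
    rw [ht₁] at ht₂
    cases ht₂
    exact hne (e₁.trans e₂.symm)

end SemiGraph

end Literature.AnabelianGeometry.SemiGraphs
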